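import Summits.NavierStokesRegularity.FluidComputer.LocalCriticalDivergence
import Literature.Analysis.FluidPDE.TsaiTopSingularNullHolds
import Mathlib.Topology.MetricSpace.HausdorffDimension
import HarnessLib

/-!
# Fluid computer — the level dictionary, PARTIAL-REGULARITY FACE (L37): the blow-up set is a nonempty compact
# `μH¹`-null set (Caffarelli–Kohn–Nirenberg at the final time)

HONEST FRAMING (cell `pub-fluidc`, verbatim): *low prior, high value-of-information experiment on Tao's
machine paradigm; NOT a claim that NS blows up.* Theorem side of the cell; nothing here is evidence of blow-up.
L33′ gives ONE singular point `x₀`; L34/L36 describe what happens around it. This module describes the WHOLE set of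
blow-up points at the lifespan `T` of a maximal smooth solution `(u, p)` of the unforced Navier–Stokes system on
`ℝ³ × [0, T)` (`ν > 0`) which is Leray–Hopf from `u 0`:

  `Σ = {x : u is essentially unbounded on every backward cylinder (T − r², T) × B_r(x)}`
  (`IsBackwardSingularPoint u (T, x)`, the tree's notion; for the class it coincides with the pointwise notion of
  L33′, `setOf_isBackwardSingularPoint_eq`).

* `hausdorffMeasure_singular_inter_ball_eq_zero`, `hausdorffMeasure_blowupSet_eq_zero` (**L37 — THE BLOW-UP SET IS
  `μH¹`-NULL**): `μH[1] Σ = 0` — Caffarelli–Kohn–Nirenberg's Theorem B AT THE TOP of the cylinder (Tsai 1998, the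
  remark after Lemma 4.2, PROVED in the tree as `tsai1998_top_singular_null_holds`, fed with the §14.3 suitable class
  on backward cylinders whose top is the lifespan, `LocalCriticalDivergence.exists_isLRSuitableWeakSolutionOn_cylinder_top`);
  hence `dimH Σ ≤ 1` (`dimH_blowupSet_le_one`).
* `exists_isBackwardSingularPoint`, `blowupSet_subset_closedBall`, `isCompact_blowupSet` (**L37′**): `Σ` is NONEMPTY
  (L33′), BOUNDED (far-field ε-regularity, L33) and CLOSED, hence COMPACT.
* `volume_line_inter_blowupSet_eq_zero` (**L37″ — NO SINGULAR FILAMENT**): every straight line meets `Σ` in a set of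
  linear measure zero; in particular `Σ` contains no segment (the axis of an axisymmetric design, the core line of a
  straight tube are a.e. regular at `T`).
* `partial_regularity_face`: the four items assembled.

Reading for the machine paradigm (words): whatever the machine, the set where it finally breaks is DUST of linear
measure zero — not a filament, not a sheet, not a tube core; a design whose mechanism needs a whole curve of
simultaneous singular points is excluded. Qualitative (no rate); the class is `ℝ³` finite energy. Necessity only.
0 sorry; no new definitions, no named facts.

## References

* L. Caffarelli, R. Kohn, L. Nirenberg, Comm. Pure Appl. Math. 35 (1982) 771–831, Theorem B and Prop. 2, §6. [CKN1982]
* T.-P. Tsai, Arch. Rational Mech. Anal. 143 (1998) 29–51, Lemma 4.2 and the remark following it (p. 46). [Tsai1998]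
* J. C. Robinson, J. L. Rodrigo, W. Sadowski, *The three-dimensional Navier–Stokes equations*, CUP 2016, Thm. 15.3,
  Thm. 16.2. [RobinsonRodrigoSadowski2016]
-/

noncomputable section

open MeasureTheory Set Function Filter Topology TopologicalSpace Metric
open scoped ENNReal NNReal
open Literature.Analysis.FluidPDE Literature.Analysis.FunctionSpaces
open Summit.NavierStokesRegularity.FluidComputer.LocalisationFace
open Summit.NavierStokesRegularity.FluidComputer.LocalCriticalDivergence

namespace Summit.NavierStokesRegularity.FluidComputer.PartialRegularityFace

/-! ## The two notions of blow-up point agree for the class -/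

/-- A point at which a classical solution on `ℝ³ × [0, T)` is unbounded on every backward parabolic neighbourhood
(at positive times) is a backward singular point in the essential sense of the tree (`IsBackwardSingularPoint`):
an essential bound on a backward cylinder is a pointwise bound on its part above `t = 0`, by continuity.
[cite: CKN1982, §6 (regular points)] -/
theorem isBackwardSingularPoint_of_unbounded {ν T : ℝ}
    {u : ℝ → EuclideanSpace ℝ (Fin 3) → EuclideanSpace ℝ (Fin 3)} {p : ℝ → EuclideanSpace ℝ (Fin 3) → ℝ}
    (hcl : IsClassicalNSSolutionOn (Ico 0 T) ν 0 u p) {x₀ : EuclideanSpace ℝ (Fin 3)}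
    (hsing : ∀ r : ℝ, 0 < r → ∀ M : ℝ, ∃ t ∈ Ioo (T - r ^ 2) T, 0 < t ∧ ∃ x ∈ ball x₀ r, M < ‖u t x‖) :
    IsBackwardSingularPoint u ((T : ℝ), x₀) := by
  intro r hr
  by_contra hne
  set W : Set (ℝ × EuclideanSpace ℝ (Fin 3)) := parabolicCylinder r ((T : ℝ), x₀) with hW
  set V : Set (ℝ × EuclideanSpace ℝ (Fin 3)) := W ∩ (Ioi (0 : ℝ) ×ˢ (univ : Set (EuclideanSpace ℝ (Fin 3))))
    with hV
  set N : ℝ := (eLpNorm (uncurry u) ⊤ (volume.restrict W)).toReal with hN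
  have haeW : ∀ᵐ z ∂(volume.restrict W), ‖uncurry u z‖ ≤ N := by
    filter_upwards [ae_le_eLpNormEssSup (f := uncurry u) (μ := volume.restrict W)] with z hz
    rw [← eLpNorm_exponent_top] at hz
    rw [← ofReal_norm] at hz
    exact (ENNReal.ofReal_le_iff_le_toReal hne).1 hz
  have haeV : ∀ᵐ z ∂(volume.restrict V), ‖uncurry u z‖ ≤ N :=
    ae_restrict_of_ae_restrict_of_subset inter_subset_left haeW
  have hVo : IsOpen V := (isOpen_parabolicCylinder _ _).inter (isOpen_Ioi.prod isOpen_univ)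
  have hVsub : V ⊆ Ico 0 T ×ˢ (univ : Set (EuclideanSpace ℝ (Fin 3))) := by
    rintro z ⟨hzW, hzt, -⟩
    rw [hW, mem_parabolicCylinder] at hzW
    exact ⟨⟨(mem_Ioi.1 hzt).le, hzW.1.2⟩, mem_univ _⟩
  have hcont : ContinuousOn (uncurry u) V := (SereginSverak2002.continuousOn_uncurry hcl).mono hVsub
  have hpt : ∀ z ∈ V, ‖uncurry u z‖ ≤ N :=
    SereginSverak2002.norm_le_of_ae_restrict_of_continuousOn hVo hcont haeV
  obtain ⟨t, ht, ht0, x, hx, hbig⟩ := hsing r hr N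
  have hmem : ((t, x) : ℝ × EuclideanSpace ℝ (Fin 3)) ∈ V := by
    refine ⟨?_, mem_Ioi.2 ht0, mem_univ _⟩
    rw [hW, mem_parabolicCylinder]
    exact ⟨⟨ht.1, ht.2⟩, mem_ball.1 hx⟩
  have hle := hpt _ hmem
  simp only [uncurry] at hle
  linarith

/-- Conversely (`T > 0`): a backward singular point in the essential sense is a point at which `u` is unbounded on
every backward parabolic neighbourhood at positive times — test the essential unboundedness on the cylinder of
radius `min r √T`, which lies above `t = 0`. [cite: CKN1982, §6 (regular points)] -/
theorem unbounded_of_isBackwardSingularPoint {T : ℝ} (hT : 0 < T)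
    {u : ℝ → EuclideanSpace ℝ (Fin 3) → EuclideanSpace ℝ (Fin 3)} {x₀ : EuclideanSpace ℝ (Fin 3)}
    (h : IsBackwardSingularPoint u ((T : ℝ), x₀)) :
    ∀ r : ℝ, 0 < r → ∀ M : ℝ, ∃ t ∈ Ioo (T - r ^ 2) T, 0 < t ∧ ∃ x ∈ ball x₀ r, M < ‖u t x‖ := by
  intro r hr M
  set r₁ : ℝ := min r (Real.sqrt T) with hr₁
  have hr₁pos : 0 < r₁ := lt_min hr (Real.sqrt_pos.2 hT)
  have hr₁r : r₁ ≤ r := min_le_left _ _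
  have hr₁T : r₁ ^ 2 ≤ T := by
    calc r₁ ^ 2 ≤ (Real.sqrt T) ^ 2 := pow_le_pow_left₀ hr₁pos.le (min_le_right _ _) 2
      _ = T := Real.sq_sqrt hT.le
  have htop := h r₁ hr₁pos
  by_contra hno
  push Not at hno
  -- then `u` is bounded by `M` everywhere on the small cylinder, which lies above `t = 0`
  have hbd : ∀ z ∈ parabolicCylinder r₁ ((T : ℝ), x₀), ‖uncurry u z‖ ≤ M := by
    intro z hz
    rw [mem_parabolicCylinder] at hz
    have hz0 : 0 < z.1 := by
      have := hz.1.1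
      simp only at this
      linarith
    have hzI : z.1 ∈ Ioo (T - r ^ 2) T := by
      refine ⟨?_, hz.1.2⟩
      have h1 : r₁ ^ 2 ≤ r ^ 2 := pow_le_pow_left₀ hr₁pos.le hr₁r 2
      have := hz.1.1
      simp only at this
      linarith
    exact hno z.1 hzI hz0 z.2 (mem_ball.2 (lt_of_lt_of_le hz.2 hr₁r))
  have hlt : eLpNorm (uncurry u) ⊤ (volume.restrict (parabolicCylinder r₁ ((T : ℝ), x₀))) < ⊤ := by
    rw [eLpNorm_exponent_top]
    refine eLpNormEssSup_lt_top_of_ae_bound (C := M) ?_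
    rw [ae_restrict_iff' (isOpen_parabolicCylinder _ _).measurableSet]
    exact Eventually.of_forall hbd
  exact hlt.ne htop

/-- **The two notions of blow-up point agree** for a classical solution on `ℝ³ × [0, T)`, `T > 0`: the tree's
essential backward singular points `(T, x)` are exactly the points at which `u` is unbounded on every backward
parabolic neighbourhood at positive times (the notion of L33′). [cite: CKN1982, §6 (regular points)] -/
theorem setOf_isBackwardSingularPoint_eq {ν T : ℝ} (hT : 0 < T)
    {u : ℝ → EuclideanSpace ℝ (Fin 3) → EuclideanSpace ℝ (Fin 3)} {p : ℝ → EuclideanSpace ℝ (Fin 3) → ℝ}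
    (hcl : IsClassicalNSSolutionOn (Ico 0 T) ν 0 u p) :
    {x | IsBackwardSingularPoint u ((T : ℝ), x)} =
      {x | ∀ r : ℝ, 0 < r → ∀ M : ℝ, ∃ t ∈ Ioo (T - r ^ 2) T, 0 < t ∧ ∃ y ∈ ball x r, M < ‖u t y‖} :=
  Set.ext fun _ => ⟨fun h => unbounded_of_isBackwardSingularPoint hT h,
    fun h => isBackwardSingularPoint_of_unbounded hcl h⟩

/-! ## L37: the blow-up set is `μH¹`-null -/

/-- **L37, local form — CKN's Theorem B at the top of a cylinder** (Tsai 1998, remark after Lemma 4.2, PROVED in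
the tree as `tsai1998_top_singular_null_holds`). For `ν > 0`, `T > 0`, a maximal smooth solution `(u, p)` of the
unforced Navier–Stokes system on `ℝ³ × [0, T)` which is Leray–Hopf from `u 0`, every centre `x₀` and every radius
`0 < ρ`, `ρ² ≤ T`: the backward singular points `(T, x)` with `x ∈ B_ρ(x₀)` form a `μH¹`-null set. The hypotheses
of the tree theorem on the cylinder `Q_ρ(T, x₀)` — the suitable class with the Riesz-gauged pressure, the energy
bound (Leray), a square-integrable weak gradient THROUGH `T`, the pressure in `L^{3/2}` — are those assembled in
`LocalCriticalDivergence.exists_isLRSuitableWeakSolutionOn_cylinder_top`.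
[cite: Tsai1998, Lemma 4.2 and the following remark (p. 46)] [cite: CKN1982, Theorem B and Prop. 2] -/
theorem hausdorffMeasure_singular_inter_ball_eq_zero {ν T : ℝ} (hν : 0 < ν) (hT : 0 < T)
    {u : ℝ → EuclideanSpace ℝ (Fin 3) → EuclideanSpace ℝ (Fin 3)} {p : ℝ → EuclideanSpace ℝ (Fin 3) → ℝ}
    (hmax : IsMaximalSmoothSolution ν 0 u p T) (hLH : IsLerayHopfOn T ν 0 (u 0) u)
    (x₀ : EuclideanSpace ℝ (Fin 3)) {ρ : ℝ} (hρ : 0 < ρ) (hρT : ρ ^ 2 ≤ T) :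
    μH[1] {x ∈ ball x₀ ρ | IsBackwardSingularPoint u ((T : ℝ), x)} = 0 := by
  set qg : ℝ → EuclideanSpace ℝ (Fin 3) → ℝ := fun t x => p t x - (p t 0 - normalisedPressure (u t) 0)
    with hqg
  -- the §14.3 class on the cylinder (weak gradient through `T`, gauged pressure in `L^{3/2}`)
  obtain ⟨G, hLR⟩ := exists_isLRSuitableWeakSolutionOn_cylinder_top hν hT hmax hLH x₀ hρ hρT
  -- the CKN suitable class on the cylinder, restricted from the open slab
  set Q : Opens (ℝ × EuclideanSpace ℝ (Fin 3)) :=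
    ⟨Ioo 0 T ×ˢ univ, isOpen_Ioo.prod isOpen_univ⟩ with hQdef
  have hQ : (Q : Set (ℝ × EuclideanSpace ℝ (Fin 3))) ⊆ Ioo 0 T ×ˢ univ := Subset.rfl
  have hsw : IsSuitableWeakSolutionOn Q ν 0 u qg :=
    SereginSverak2002.isSuitableWeakSolutionOn_gauge_of_classical hν hT hmax.1 hLH Q hQ
  have hΩle : parabolicCylinderOpens ρ ((T : ℝ), x₀) ≤ Q := by
    intro z hz
    have hz' : z ∈ parabolicCylinder ρ ((T : ℝ), x₀) := hz
    rw [mem_parabolicCylinder] at hz'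
    exact ⟨⟨by nlinarith [hz'.1.1], hz'.1.2⟩, mem_univ _⟩
  have hsuit : IsSuitableWeakSolutionOn (parabolicCylinderOpens ρ ((T : ℝ), x₀)) ν 0 u qg := hsw.of_le hΩle
  -- the energy bound on the cylinder from Leray's energy inequality
  have hu0 : MemLp (u 0) 2 volume := hLH.memLp 0 ⟨le_rfl, hT.le⟩
  have henergy : ∃ C : ℝ≥0, ∀ᵐ t : ℝ, t ∈ Ioo (T - ρ ^ 2) T →
      ∫⁻ x in ball x₀ ρ, ‖u t x‖ₑ ^ 2 ≤ C := by
    refine ⟨((eLpNorm (u 0) 2 volume) ^ 2).toNNReal, ae_of_all _ fun t ht => ?_⟩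
    rw [ENNReal.coe_toNNReal (ENNReal.pow_ne_top hu0.eLpNorm_ne_top)]
    have htI : t ∈ Icc 0 T := ⟨by nlinarith [ht.1], ht.2.le⟩
    have h2 := eLpNorm_natCast_pow_eq_lintegral volume (u t) (n := 2) (by norm_num)
    simp only [Nat.cast_ofNat] at h2
    calc ∫⁻ x in ball x₀ ρ, ‖u t x‖ₑ ^ 2 ≤ ∫⁻ x, ‖u t x‖ₑ ^ 2 := setLIntegral_le_lintegral _ _
      _ = eLpNorm (u t) 2 volume ^ 2 := h2.symm
      _ ≤ eLpNorm (u 0) 2 volume ^ 2 := pow_le_pow_left' (hLH.eLpNorm_le_eLpNorm_datum hν.le hu0 htI) 2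
  exact tsai1998_top_singular_null_holds hν hρ hsuit henergy ⟨G, hLR.weakGradient, hLR.gradient_lt_top⟩
    hLR.pressure_lt_top

/-- **L37 — THE BLOW-UP SET IS `μH¹`-NULL** (Caffarelli–Kohn–Nirenberg's Theorem B at the final time). For
`ν > 0`, `T > 0` and every maximal smooth solution `(u, p)` of the unforced Navier–Stokes system on `ℝ³ × [0, T)`
which is Leray–Hopf from `u 0`: the set of `x` such that `(T, x)` is a backward singular point has one-dimensional
Hausdorff measure zero — `μH[1] {x | IsBackwardSingularPoint u (T, x)} = 0` (countably many balls of radius `√T`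
cover `ℝ³`). [cite: CKN1982, Theorem B] [cite: Tsai1998, Lemma 4.2 and the following remark (p. 46)] -/
theorem hausdorffMeasure_blowupSet_eq_zero {ν T : ℝ} (hν : 0 < ν) (hT : 0 < T)
    {u : ℝ → EuclideanSpace ℝ (Fin 3) → EuclideanSpace ℝ (Fin 3)} {p : ℝ → EuclideanSpace ℝ (Fin 3) → ℝ}
    (hmax : IsMaximalSmoothSolution ν 0 u p T) (hLH : IsLerayHopfOn T ν 0 (u 0) u) :
    μH[1] {x | IsBackwardSingularPoint u ((T : ℝ), x)} = 0 := by
  set ρ : ℝ := Real.sqrt T with hρ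
  have hρpos : 0 < ρ := Real.sqrt_pos.2 hT
  have hρT : ρ ^ 2 ≤ T := (Real.sq_sqrt hT.le).le
  obtain ⟨D, hDc, hDd⟩ := TopologicalSpace.exists_countable_dense (EuclideanSpace ℝ (Fin 3))
  have hcover : {x | IsBackwardSingularPoint u ((T : ℝ), x)} ⊆
      ⋃ c ∈ D, {x ∈ ball c ρ | IsBackwardSingularPoint u ((T : ℝ), x)} := by
    intro x hx
    obtain ⟨c, hcD, hxc⟩ := hDd.exists_dist_lt x hρpos
    exact mem_biUnion hcD ⟨mem_ball.2 hxc, hx⟩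
  refine measure_mono_null hcover ((measure_biUnion_null_iff hDc).2 fun c _ => ?_)
  exact hausdorffMeasure_singular_inter_ball_eq_zero hν hT hmax hLH c hρpos hρT

/-- Hence the blow-up set has Hausdorff dimension at most one. [cite: CKN1982, Theorem B] -/
theorem dimH_blowupSet_le_one {ν T : ℝ} (hν : 0 < ν) (hT : 0 < T)
    {u : ℝ → EuclideanSpace ℝ (Fin 3) → EuclideanSpace ℝ (Fin 3)} {p : ℝ → EuclideanSpace ℝ (Fin 3) → ℝ}
    (hmax : IsMaximalSmoothSolution ν 0 u p T) (hLH : IsLerayHopfOn T ν 0 (u 0) u) :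
    dimH {x | IsBackwardSingularPoint u ((T : ℝ), x)} ≤ 1 := by
  have h := hausdorffMeasure_blowupSet_eq_zero hν hT hmax hLH
  have h' : μH[((1 : ℝ≥0) : ℝ)] {x | IsBackwardSingularPoint u ((T : ℝ), x)} ≠ ⊤ := by
    rw [NNReal.coe_one, h]
    exact ENNReal.zero_ne_top
  exact_mod_cast dimH_le_of_hausdorffMeasure_ne_top h'

/-! ## L37′: the blow-up set is nonempty and compact -/

/-- **The blow-up set is nonempty**: the singular point of L33′ (`LocalisationFace.exists_singularPoint`) is a
backward singular point. [cite: CKN1982, §6] -/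
theorem exists_isBackwardSingularPoint {ν T : ℝ} (hν : 0 < ν) (hT : 0 < T)
    {u : ℝ → EuclideanSpace ℝ (Fin 3) → EuclideanSpace ℝ (Fin 3)} {p : ℝ → EuclideanSpace ℝ (Fin 3) → ℝ}
    (hmax : IsMaximalSmoothSolution ν 0 u p T) (hLH : IsLerayHopfOn T ν 0 (u 0) u) :
    ∃ x₀ : EuclideanSpace ℝ (Fin 3), IsBackwardSingularPoint u ((T : ℝ), x₀) := by
  obtain ⟨x₀, hsing⟩ := exists_singularPoint hν hT hmax hLH
  exact ⟨x₀, isBackwardSingularPoint_of_unbounded hmax.1 hsing⟩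

/-- **The blow-up set is bounded**: it lies in a fixed closed ball — outside `B̄(0, R)` the solution is bounded on
`(T/2, T)` (far-field ε-regularity, L33 `LocalisationFace.exists_ball_rate`), so every `x` with `‖x‖ > R + 1` has a
bounded backward cylinder. [cite: CKN1982, §6] -/
theorem blowupSet_subset_closedBall {ν T : ℝ} (hν : 0 < ν) (hT : 0 < T)
    {u : ℝ → EuclideanSpace ℝ (Fin 3) → EuclideanSpace ℝ (Fin 3)} {p : ℝ → EuclideanSpace ℝ (Fin 3) → ℝ}
    (hmax : IsMaximalSmoothSolution ν 0 u p T) (hLH : IsLerayHopfOn T ν 0 (u 0) u) :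
    ∃ R : ℝ, {x | IsBackwardSingularPoint u ((T : ℝ), x)} ⊆ closedBall (0 : EuclideanSpace ℝ (Fin 3)) R := by
  obtain ⟨c, -, H⟩ := exists_ball_rate
  obtain ⟨R, M, t₁, -, -, -, hfar, -⟩ := H ν T hν hT u p hmax hLH
  refine ⟨R + 1, fun x hx => ?_⟩
  rw [mem_closedBall, dist_zero_right]
  by_contra hxR
  rw [not_le] at hxR
  -- the cylinder of radius `r = min 1 √(T/2)` around `(T, x)` lies in the far field after `T/2`
  set r : ℝ := min 1 (Real.sqrt (T / 2)) with hr
  have hT2 : 0 < T / 2 := by linarith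
  have hrpos : 0 < r := lt_min one_pos (Real.sqrt_pos.2 hT2)
  have hr1 : r ≤ 1 := min_le_left _ _
  have hrT : r ^ 2 ≤ T / 2 := by
    calc r ^ 2 ≤ (Real.sqrt (T / 2)) ^ 2 := pow_le_pow_left₀ hrpos.le (min_le_right _ _) 2
      _ = T / 2 := Real.sq_sqrt hT2.le
  have hbd : ∀ z ∈ parabolicCylinder r ((T : ℝ), x), ‖uncurry u z‖ ≤ M := by
    intro z hz
    rw [mem_parabolicCylinder] at hz
    have hz1 : z.1 ∈ Ioo (T / 2) T := by
      refine ⟨?_, hz.1.2⟩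
      have := hz.1.1
      simp only at this
      linarith
    have hz2 : R < ‖z.2‖ := by
      have hd : dist z.2 x < r := hz.2
      rw [dist_eq_norm] at hd
      have h1 : ‖x‖ ≤ ‖z.2‖ + ‖z.2 - x‖ := by
        calc ‖x‖ = ‖z.2 - (z.2 - x)‖ := by rw [sub_sub_cancel]
          _ ≤ ‖z.2‖ + ‖z.2 - x‖ := norm_sub_le _ _
      linarith
    exact hfar z.1 hz1 z.2 hz2
  have hlt : eLpNorm (uncurry u) ⊤ (volume.restrict (parabolicCylinder r ((T : ℝ), x))) < ⊤ := by
    rw [eLpNorm_exponent_top]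
    refine eLpNormEssSup_lt_top_of_ae_bound (C := M) ?_
    rw [ae_restrict_iff' (isOpen_parabolicCylinder _ _).measurableSet]
    exact Eventually.of_forall hbd
  exact hlt.ne (hx r hrpos)

/-- **The blow-up set is closed**: its complement is open, since a bounded backward cylinder at `(T, x)` contains
the backward cylinders of half the radius at all nearby points. [cite: CKN1982, §6 (the regular set is open)] -/
theorem isClosed_blowupSet {T : ℝ} (u : ℝ → EuclideanSpace ℝ (Fin 3) → EuclideanSpace ℝ (Fin 3)) :
    IsClosed {x | IsBackwardSingularPoint u ((T : ℝ), x)} := by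
  rw [← isOpen_compl_iff, Metric.isOpen_iff]
  intro x hx
  rw [mem_compl_iff, mem_setOf_eq, IsBackwardSingularPoint] at hx
  push Not at hx
  obtain ⟨r, hr, hne⟩ := hx
  refine ⟨r / 2, by positivity, fun x' hx' hsing => ?_⟩
  have hsub : parabolicCylinder (r / 2) ((T : ℝ), x') ⊆ parabolicCylinder r ((T : ℝ), x) := by
    intro w hw
    rw [mem_parabolicCylinder] at hw ⊢
    refine ⟨⟨?_, hw.1.2⟩, ?_⟩
    · have := hw.1.1
      simp only at this ⊢
      nlinarith
    · have hd : dist x' x < r / 2 := mem_ball.1 hx'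
      calc dist w.2 x ≤ dist w.2 x' + dist x' x := dist_triangle _ _ _
        _ < r / 2 + r / 2 := add_lt_add hw.2 hd
        _ = r := by ring
  have hle : eLpNorm (uncurry u) ⊤ (volume.restrict (parabolicCylinder (r / 2) ((T : ℝ), x'))) ≤
      eLpNorm (uncurry u) ⊤ (volume.restrict (parabolicCylinder r ((T : ℝ), x))) :=
    eLpNorm_mono_measure _ (Measure.restrict_mono hsub le_rfl)
  have htop := hsing (r / 2) (by positivity)
  rw [htop, top_le_iff] at hle
  exact hne hle

/-- **L37′ — THE BLOW-UP SET IS COMPACT** (closed and bounded in `ℝ³`). [cite: CKN1982, §6] -/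
theorem isCompact_blowupSet {ν T : ℝ} (hν : 0 < ν) (hT : 0 < T)
    {u : ℝ → EuclideanSpace ℝ (Fin 3) → EuclideanSpace ℝ (Fin 3)} {p : ℝ → EuclideanSpace ℝ (Fin 3) → ℝ}
    (hmax : IsMaximalSmoothSolution ν 0 u p T) (hLH : IsLerayHopfOn T ν 0 (u 0) u) :
    IsCompact {x | IsBackwardSingularPoint u ((T : ℝ), x)} := by
  obtain ⟨R, hR⟩ := blowupSet_subset_closedBall hν hT hmax hLH
  exact (isCompact_closedBall _ _).of_isClosed_subset (isClosed_blowupSet u) hR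

/-! ## L37″: no singular filament -/

/-- **L37″ — NO SINGULAR FILAMENT: every straight line meets the blow-up set in a set of linear measure zero.**
For every point `a` and unit vector `v`, `volume {s : ℝ | (T, a + s • v) is a backward singular point} = 0`
(the parametrisation `s ↦ a + s • v` is an isometry, so the linear measure of the trace is the `μH¹`-measure of a
subset of the blow-up set). In particular the blow-up set contains no segment. [cite: CKN1982, Theorem B] -/
theorem volume_line_inter_blowupSet_eq_zero {ν T : ℝ} (hν : 0 < ν) (hT : 0 < T)
    {u : ℝ → EuclideanSpace ℝ (Fin 3) → EuclideanSpace ℝ (Fin 3)} {p : ℝ → EuclideanSpace ℝ (Fin 3) → ℝ}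
    (hmax : IsMaximalSmoothSolution ν 0 u p T) (hLH : IsLerayHopfOn T ν 0 (u 0) u)
    (a v : EuclideanSpace ℝ (Fin 3)) (hv : ‖v‖ = 1) :
    volume {s : ℝ | IsBackwardSingularPoint u ((T : ℝ), a + s • v)} = 0 := by
  set f : ℝ → EuclideanSpace ℝ (Fin 3) := fun s => a + s • v with hf
  have hiso : Isometry f := by
    refine Isometry.of_dist_eq fun s t => ?_
    simp only [hf, dist_eq_norm, add_sub_add_left_eq_sub, ← sub_smul, norm_smul, Real.norm_eq_abs, hv, mul_one]
  have hpre : {s : ℝ | IsBackwardSingularPoint u ((T : ℝ), a + s • v)} =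
      f ⁻¹' {x | IsBackwardSingularPoint u ((T : ℝ), x)} := rfl
  rw [hpre, ← hausdorffMeasure_real, hiso.hausdorffMeasure_preimage (Or.inl zero_le_one)]
  exact measure_mono_null inter_subset_left (hausdorffMeasure_blowupSet_eq_zero hν hT hmax hLH)

/-! ## The face assembled -/

/-- **THE PARTIAL-REGULARITY FACE OF THE LEVEL DICTIONARY, ASSEMBLED.** For `ν > 0`, `T > 0` and every maximal
smooth solution `(u, p)` of the unforced Navier–Stokes system on `ℝ³ × [0, T)` which is Leray–Hopf from `u 0`, the
blow-up set `Σ = {x | IsBackwardSingularPoint u (T, x)}` (= the points at which `u` is unbounded on every backward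
parabolic neighbourhood, `setOf_isBackwardSingularPoint_eq`) is (N) nonempty, (C) compact, (H) `μH¹`-null, and
(L) meets every straight line in a set of linear measure zero. [cite: CKN1982, Theorem B]
[cite: Tsai1998, Lemma 4.2 and the following remark (p. 46)] -/
theorem partial_regularity_face {ν T : ℝ} (hν : 0 < ν) (hT : 0 < T)
    {u : ℝ → EuclideanSpace ℝ (Fin 3) → EuclideanSpace ℝ (Fin 3)} {p : ℝ → EuclideanSpace ℝ (Fin 3) → ℝ}
    (hmax : IsMaximalSmoothSolution ν 0 u p T) (hLH : IsLerayHopfOn T ν 0 (u 0) u) :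
    {x | IsBackwardSingularPoint u ((T : ℝ), x)}.Nonempty ∧
      IsCompact {x | IsBackwardSingularPoint u ((T : ℝ), x)} ∧
      μH[1] {x | IsBackwardSingularPoint u ((T : ℝ), x)} = 0 ∧
      ∀ (a v : EuclideanSpace ℝ (Fin 3)), ‖v‖ = 1 →
        volume {s : ℝ | IsBackwardSingularPoint u ((T : ℝ), a + s • v)} = 0 :=
  ⟨exists_isBackwardSingularPoint hν hT hmax hLH, isCompact_blowupSet hν hT hmax hLH,
    hausdorffMeasure_blowupSet_eq_zero hν hT hmax hLH,
    fun a v hv => volume_line_inter_blowupSet_eq_zero hν hT hmax hLH a v hv⟩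

end Summit.NavierStokesRegularity.FluidComputer.PartialRegularityFace

end
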